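import Summits.Ventures.CertifiedQuantumChemistry.Certificates.HubbardRingL6SingletLiftFeasible
import Summits.Ventures.CertifiedQuantumChemistry.Rows.HubbardRingL6StrongCouplingLimit
import HarnessLib

/-!
# Ventures/CertifiedQuantumChemistry — Certificates/HubbardRingL6SingletLiftPlateauFloor.lean: the KERNEL-GRADE PLATEAU FLOOR of the
# half-filled Hubbard 6-ring AT THE DQG+S² LEVEL — `OPT_DQG+S²(hubbardRingTV 6 1 U; N = 6, S = 0) ≤ v*ˢ/U` for every rational `U ≥ 2⁵¹`
# (`v*ˢ = −2404245335321173946925986187/112589990684262400000000000 ≈ −21.35399`), hence for every `c < c⋆ˢ := −(5+√13)/2 − v*ˢ/4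
# ≈ 1.0357214`, eventually in `U`, `c ≤ (U/4)·(E₀ − OPT_DQG+S²)`: `liminf_U ĉ_DQG+S²(6; U) ≥ 1.0357214`, per site `≥ 0.17262`

HONEST FRAMING (verbatim): certified bounds for a stated model Hamiltonian in a stated basis; not a
claim about the real molecule beyond that model.

Seat rdm-B (gen 43; the DQG+S² twin of `…L6LiftPlateauFloor.lean` of the same gen). INPUTS: `…L6SingletLiftFeasible.lean` (the exact
singlet lift family is `IsDQGFeasibleSinglet 3`-feasible for `0 < ε ≤ 2⁻⁵¹`), gen 39's ring energy formula
`RingEnergy.hubbardRingTV_re_rdmEnergy_eq`, the objective sums `LiftL6.l6s_objective_sums` (`B₁ˢ`, `D₂ˢ`), the Literature bound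
`pqgSingletEnergy_le_rdmEnergy` (`SingletRestrictedRelaxation`), and — on the `E₀` side — the typer's `tendsto_mul_energy_hubbardRingTV_six`
(`U·E₀(hubbardRingTV 6 1 U; 3, 3) → −2(5 + √13)`; `E₀` in the SECTOR spelling `(3, 3)`, exactly as conjecture S-U's DQG+S² clause
`ConjectureSU_DQGS2` phrases the gap).

THE THEOREMS: **`lift6s_re_rdmEnergy`** — at `ε = 1/U` the singlet family member's energy is EXACTLY `v*ˢ/U`;
**`lift6s_pqgSingletEnergy_le`** — `Model.pqgSingletEnergy (hubbardRingTV 6 1 U) 3 ≤ v*ˢ/U` for every rational `U ≥ 2⁵¹`;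
**`eventually_mul_pqgSingletEnergy_le_vstar`**; **`eventually_le_scaled_singlet_gap6`** — for every `c < c⋆ˢ`, `∀ᶠ U in atTop (ℚ),
c ≤ (U/4)·(Model.energy _ 3 3 − Model.pqgSingletEnergy _ 3)`; **`l6scFloor_gt`** / **`l6scFloor_lt`** — `1.0357214 < c⋆ˢ < 1.0357215`;
**`l6scFloor_le_of_tendsto`**; **`l6scFloor_le_of_conjectureSU_clause`** — on the convergence clause of `ConjectureSU_DQGS2` any candidate
plateau function has `c 3 ≥ c⋆ˢ > 1.0357214`, so S-U's registered DQG+S² bracket `c 3 ∈ [1, 1.05]` can only be met in `[c⋆ˢ, 1.05]`;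
**`eventually_dqgS2_not_exact6`** — eventual NON-exactness of the DQG+S² relaxation on the 6-ring (contrast: at `L = 4` the DQG+S² level
is exact in the limit, S-U's `c 2 = 0`).

READING. The LOWER half, at kernel grade, of the `L = 6`, level DQG+S² entry of STRUCTURE §2.2.14 (until now words + exact-certificate
grade, `liminf_U ĉ_DQG+S²(6;U) ≥ 1.0357214185`): adding the `⟨Ŝ²⟩ = 0` row to the two-positivity conditions still misses AT LEAST
`c⋆ˢ·J ≈ 1.0357·J` of the 6-ring's ground-state energy at strong coupling (`J = 4t²/U`), `≥ 0.1726·J` per site. Nothing is claimed about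
an UPPER bound on the scaled gap, the existence of the limit, or `L ≥ 8`; no clause of S-U is proved or refuted (`[1, 1.05]` meets
`[c⋆ˢ, ∞)`). NOT a row of `CERTIFIED.md`, no claim node; S-U UNTOUCHED. 0 sorry; two small `def`s (`l6svstar`, `l6scFloor`); standard
axioms. References (docstring-only): D. A. Mazziotti, Adv. Chem. Phys. 134 (2007) ch. 3 §II.B, §II.F, §II.F.1; M. Nakata et al., J. Chem.
Phys. 128 (2008) 164113 §II.C.
-/


set_option linter.style.longLine false

namespace Summit.Ventures.CertifiedQuantumChemistry

namespace LiftL6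

open Matrix Finset DQGGap Filter Topology
open Literature.MathematicalPhysics.QuantumLattice Literature.MathematicalPhysics.QuantumChemistry
open Summit.Ventures.CertifiedQuantumChemistry.Hamiltonians
open scoped ComplexOrder

/-! ## §1 The constants, the energy along the family and the bound on `OPT_DQG` -/

/-- **`v*ˢ`**: the exact value of `U·Re E` along the L = 6 singlet lift family at `ε = 1/U` (`= −2B₁ˢ + D₂ˢ ≈ −21.35398822`). -/
def l6svstar : ℚ := -2404245335321173946925986187 / 112589990684262400000000000

/-- **`c⋆ˢ = −(5 + √13)/2 − v*ˢ/4 ≈ 1.0357214185`**: the kernel-grade floor of the 6-ring's scaled DQG+S² gap at strong coupling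
(`−(5+√13)/2 = lim U·E₀/4`, the typer's T-K0-6). -/
noncomputable def l6scFloor : ℝ := -(5 + Real.sqrt 13) / 2 - (l6svstar : ℝ) / 4

/-- `v*ˢ = −2B₁ˢ + D₂ˢ` (the objective sums of `…L6SingletLiftCoeffRows` §4). -/
theorem l6svstar_eq : (l6svstar : ℝ) =
    -2 * (((1202122667662284673323256941 : ℚ) / 56294995342131200000000000 : ℚ) : ℝ) +
      (((2404245335327964746367041577 : ℚ) / 112589990684262400000000000 : ℚ) : ℝ) := by
  rw [l6svstar]; push_cast; norm_num

/-- Bond sum of the singlet one-matrix family: `Σ_{p,σ} γˢ(pσ; (p+1)σ) = ε·B₁ˢ`. -/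
theorem liftGamR6s_bond (ε : ℝ) :
    ∑ p : Fin 6, ∑ σ : Fin 2, liftGamR6s ε (orb p σ) (orb (finRotate 6 p) σ) =
      ε * (((1202122667662284673323256941 : ℚ) / 56294995342131200000000000 : ℚ) : ℝ) := by
  simp only [liftGamR6s_orb]
  simp only [sum_family6]
  simp only [l6s_objective_sums.1]
  simp [Fin.sum_univ_three]

/-- Doublon sum of the singlet two-matrix family: `Σ_p Γˢ(p↑ p↓; p↑ p↓) = ε²·D₂ˢ`. -/
theorem liftGGR6s_doublon (ε : ℝ) :
    ∑ p : Fin 6, liftGGR6s ε (orb p 0, orb p 1) (orb p 0, orb p 1) =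
      ε ^ 2 * (((2404245335327964746367041577 : ℚ) / 112589990684262400000000000 : ℚ) : ℝ) := by
  simp only [liftGGR6s_orb]
  simp only [sum_family6]
  simp only [l6s_objective_sums.2]
  simp [Fin.sum_univ_three]

/-- **THE ENERGY OF THE SINGLET FAMILY** for `hubbardRingTV 6 1 U` at `ε = 1/U` (`U ≠ 0`): `Re E = v*ˢ/U` EXACTLY
(gen 39's ring energy formula `Re E = −2t·Σ bonds + U·Σ doublons`; only Hermiticity and antisymmetry are used). -/
theorem lift6s_re_rdmEnergy (U : ℚ) (hU : U ≠ 0) :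
    (rdmEnergy (fun p q => ((hubbardRingTV 6 1 U).h p q : ℂ)) (fun p q r s => ((hubbardRingTV 6 1 U).eri p q r s : ℂ))
        ((hubbardRingTV 6 1 U).ecore : ℂ) (liftGamC6s (1 / U)) (liftGGC6s (1 / U))).re = (l6svstar : ℝ) / U := by
  have hγ : ∀ x y, liftGamC6s (1 / U) x y = ((liftGamR6s (1 / U) x y : ℝ) : ℂ) := fun _ _ => rfl
  have hΓ : ∀ P R, liftGGC6s (1 / U) P R = ((liftGGR6s (1 / U) P R : ℝ) : ℂ) := fun _ _ => rfl
  rw [RingEnergy.hubbardRingTV_re_rdmEnergy_eq (by norm_num) 1 U (liftGamC6s_isHermitian _) (liftGGC6s_swap_fst _)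
    (liftGGC6s_swap_snd _)]
  simp only [hγ, hΓ, Complex.ofReal_re, liftGamR6s_bond, liftGGR6s_doublon, l6svstar_eq]
  have hU' : (U : ℝ) ≠ 0 := by exact_mod_cast hU
  push_cast
  field_simp

/-- **`OPT_DQG+S² ≤ v*ˢ/U` FOR EVERY RATIONAL `U ≥ 2⁵¹`**: the singlet-restricted programme's value on `hubbardRingTV 6 1 U` (`N = 6`,
`S = 0`) lies below the energy of the singlet-feasible family member at `ε = 1/U`. -/
theorem lift6s_pqgSingletEnergy_le {U : ℚ} (hU : (2 : ℚ) ^ 51 ≤ U) :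
    Model.pqgSingletEnergy (hubbardRingTV 6 1 U) 3 ≤ (l6svstar : ℝ) / U := by
  have hU0 : (0 : ℚ) < U := lt_of_lt_of_le (by positivity) hU
  have hUq : U ≠ 0 := hU0.ne'
  have hε0 : (0 : ℝ) < 1 / U := by
    have : (0 : ℝ) < U := by exact_mod_cast hU0
    positivity
  have hε1 : (1 : ℝ) / U ≤ 1 / 2 ^ 51 := by
    have h : ((2 : ℚ) ^ 51 : ℝ) ≤ (U : ℝ) := by exact_mod_cast hU
    push_cast at h
    exact one_div_le_one_div_of_le (by positivity) h
  have hf := lift6s_isDQGFeasibleSinglet hε0 hε1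
  have h := pqgSingletEnergy_le_rdmEnergy (fun p q => ((hubbardRingTV 6 1 U).h p q : ℂ))
    (fun p q r s => ((hubbardRingTV 6 1 U).eri p q r s : ℂ)) ((hubbardRingTV 6 1 U).ecore : ℂ) hf
  rw [lift6s_re_rdmEnergy U hUq] at h
  exact h

/-! ## §2 The kernel-grade plateau floor: `liminf_U (U/4)·(E₀ − OPT_DQG+S²) ≥ c⋆ˢ` on the 6-ring -/

/-- **`U·OPT_DQG+S² ≤ v*ˢ` EVENTUALLY** (indeed for every rational `U ≥ 2⁵¹`). -/
theorem eventually_mul_pqgSingletEnergy_le_vstar :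
    ∀ᶠ U : ℚ in atTop, (U : ℝ) * Model.pqgSingletEnergy (hubbardRingTV 6 1 U) 3 ≤ (l6svstar : ℝ) := by
  filter_upwards [eventually_ge_atTop ((2 : ℚ) ^ 51)] with U hU
  have hU0 : (0 : ℝ) < U := by exact_mod_cast lt_of_lt_of_le (by positivity) hU
  have h := lift6s_pqgSingletEnergy_le hU
  rwa [le_div_iff₀ hU0, mul_comm] at h

/-- **THE PLATEAU FLOOR (DQG+S²).** For every `c < c⋆ˢ = −(5+√13)/2 − v*ˢ/4`, eventually (as `U → ∞` along `ℚ`)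
`c ≤ (U/4)·(E₀(6; 1, U; 3, 3) − OPT_DQG+S²(6; 1, U; N = 6, S = 0))`: S-U's 6-ring DQG+S² plateau constant is AT LEAST `c⋆ˢ ≈ 1.0357214`
at kernel grade (the `E₀` side is the typer's `U·E₀ → −2(5+√13)`, `Rows/HubbardRingL6StrongCouplingLimit.lean`). -/
theorem eventually_le_scaled_singlet_gap6 {c : ℝ} (hc : c < l6scFloor) :
    ∀ᶠ U : ℚ in atTop, c ≤ (U : ℝ) / 4 *
      (Model.energy (hubbardRingTV 6 1 U) 3 3 - Model.pqgSingletEnergy (hubbardRingTV 6 1 U) 3) := by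
  have hδ : 0 < l6scFloor - c := by linarith
  have hE : ∀ᶠ U : ℚ in atTop, -(2 * (5 + Real.sqrt 13)) - 4 * (l6scFloor - c) < (U : ℝ) * (hubbardRingTV 6 1 U).energy 3 3 :=
    tendsto_mul_energy_hubbardRingTV_six.eventually (lt_mem_nhds (by linarith))
  filter_upwards [hE, eventually_mul_pqgSingletEnergy_le_vstar] with U h1 h2
  have : (U : ℝ) / 4 * (Model.energy (hubbardRingTV 6 1 U) 3 3 - Model.pqgSingletEnergy (hubbardRingTV 6 1 U) 3) =
      ((U : ℝ) * (hubbardRingTV 6 1 U).energy 3 3 - (U : ℝ) * Model.pqgSingletEnergy (hubbardRingTV 6 1 U) 3) / 4 := by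
    ring
  rw [this]
  have hc' : l6scFloor = -(5 + Real.sqrt 13) / 2 - (l6svstar : ℝ) / 4 := rfl
  rw [hc'] at hδ h1
  linarith

/-- **`c⋆ˢ > 1.0357214`** (from `√13 < 3.60555128`). Per site: `c⋆ˢ/6 > 0.17262`. -/
theorem l6scFloor_gt : (1.0357214 : ℝ) < l6scFloor := by
  have h13 : Real.sqrt 13 < 3.60555128 := by
    rw [show (3.60555128 : ℝ) = Real.sqrt (3.60555128 ^ 2) by rw [Real.sqrt_sq (by norm_num)]]
    exact Real.sqrt_lt_sqrt (by norm_num) (by norm_num)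
  rw [l6scFloor, l6svstar]
  push_cast
  nlinarith

/-- **`c⋆ˢ < 1.0357215`** (from `√13 > 3.60555127`). -/
theorem l6scFloor_lt : l6scFloor < (1.0357215 : ℝ) := by
  have h13 : (3.60555127 : ℝ) < Real.sqrt 13 := by
    rw [show (3.60555127 : ℝ) = Real.sqrt (3.60555127 ^ 2) by rw [Real.sqrt_sq (by norm_num)]]
    exact Real.sqrt_lt_sqrt (by norm_num) (by norm_num)
  rw [l6scFloor, l6svstar]
  push_cast
  nlinarith

/-- **COROLLARY (the limit, if it exists, is at least `c⋆ˢ`).** If the scaled DQG+S² gap of the 6-ring converges along `ℚ`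
(as S-U conjectures, `Rows/ConjectureSU.lean`, `ConjectureSU_DQGS2`), its limit is `≥ c⋆ˢ > 1.0357214`. -/
theorem l6scFloor_le_of_tendsto {c₀ : ℝ} (h : Tendsto (fun U : ℚ => (U : ℝ) / 4 *
      (Model.energy (hubbardRingTV 6 1 U) 3 3 - Model.pqgSingletEnergy (hubbardRingTV 6 1 U) 3)) atTop (𝓝 c₀)) :
    l6scFloor ≤ c₀ :=
  le_of_forall_lt_imp_le_of_dense fun _ hc => ge_of_tendsto h (eventually_le_scaled_singlet_gap6 hc)

/-- **COROLLARY (S-U's shape).** For ANY candidate plateau function `c : ℕ → ℝ` satisfying the convergence clause of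
conjecture S-U, level DQG+S² (`Rows/ConjectureSU.lean`, `ConjectureSU_DQGS2`: for every `n ≥ 2` the scaled DQG+S² gap of the
ring `L = 2n` tends to `c n`), the 6-ring constant obeys `c⋆ˢ ≤ c 3` — so S-U's registered bracket `c 3 ∈ [1, 1.05]` can only be met in
`[c⋆ˢ, 1.05] ⊂ (1.0357214, 1.05]`. (S-U itself is neither proved nor refuted here.) -/
theorem l6scFloor_le_of_conjectureSU_clause {c : ℕ → ℝ}
    (h : ∀ n, 2 ≤ n → 0 ≤ c n ∧
      Tendsto (fun U : ℚ => ((U : ℝ) / 4) *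
          (Model.energy (hubbardRingTV (2*n) 1 U) n n - Model.pqgSingletEnergy (hubbardRingTV (2*n) 1 U) n))
        atTop (𝓝 (c n))) :
    l6scFloor ≤ c 3 :=
  l6scFloor_le_of_tendsto (h 3 (by norm_num)).2

/-- **COROLLARY (eventual non-exactness).** The DQG+S² relaxation is NOT exact on the half-filled Hubbard 6-ring at every
sufficiently large `U` (along `ℚ`): `∀ᶠ U, OPT_DQG+S²(hubbardRingTV 6 1 U; 6, S = 0) < E₀(hubbardRingTV 6 1 U; 3, 3)` — the plateau
floor with `c = 1 < c⋆ˢ` (contrast `L = 4`, where S-U records `c 2 = 0` at this level). -/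
theorem eventually_dqgS2_not_exact6 :
    ∀ᶠ U : ℚ in atTop, Model.pqgSingletEnergy (hubbardRingTV 6 1 U) 3 < Model.energy (hubbardRingTV 6 1 U) 3 3 := by
  have hc : (1 : ℝ) < l6scFloor := lt_trans (by norm_num) l6scFloor_gt
  filter_upwards [eventually_le_scaled_singlet_gap6 hc, eventually_gt_atTop (0 : ℚ)] with U h1 h2
  have hU : (0 : ℝ) < U := by exact_mod_cast h2
  have h3 : 0 < (U : ℝ) / 4 *
      (Model.energy (hubbardRingTV 6 1 U) 3 3 - Model.pqgSingletEnergy (hubbardRingTV 6 1 U) 3) :=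
    lt_of_lt_of_le (by norm_num) h1
  rcases mul_pos_iff.mp h3 with ⟨_, h⟩ | ⟨h, _⟩
  · linarith
  · linarith

end LiftL6

end Summit.Ventures.CertifiedQuantumChemistry
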